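import Literature.Analysis.OperatorTheory.Enflo2023.StepRealisationDiagNFloor
import HarnessLib

/-!
# Enflo (2023), Part B — admissible CYCLIC starts of the Main Construction exist in every dimension `d ≥ 2`
(`StepRealisation.DiagN`, non-vacuity of the general-`d` calibration)

WHAT THIS FILE DECIDES.  `StepRealisationDiagN` (`DiagN.indepRunD_etheta_eq_zero`) and `StepRealisationDiagNFloor`
(`DiagN.reachD_etheta_floor`) are hypothetical in an admissible start: a unit vector `x₀ ∈ ℂ^d`, a true MC state
`s₀` of an intertwiner `V S = T_w V` over the shift on `ℓ²` with `(εθ)₀ > 0`, the run's start margin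
`0.09 + (22/σ + 1)(εθ)₀ ≤ ε₀² ≤ 0.49 − (22/σ + 1)(εθ)₀`, and a run vector `y₀` with no vanishing eigen-coordinate
(`cf s₀.V i ≠ 0` for all `i`).  So far such a start was exhibited in the tree only for `d = 2`, `w = (τ, τ/2)`
(`DiagN.not_indepRunD_two`, transferred from `Diag.exists_start_at`).  This file constructs one for EVERY `d ≥ 2`
and EVERY real weight vector `w` with `|w_i| ≤ τ ≤ 1/100` (`DiagN.exists_start`), and records the corollaries: the
orbit residual `IndepRunD` (and `IndepRunκ`) FAILS, non-vacuously, for every real diagonal operator with simple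
spectrum `≤ σ/100` on every `ℂ^d`, `d ≥ 2`, and the finite-depth floor of the orbit tree is attained there
(`DiagN.not_indepRunD`, last conjunct).

THE START (v2 (2)–(4) p.2, (15)–(16) p.6, the window of `ε` p.17).  Intertwiners with prescribed real
eigen-coefficients `W_c b := Σ_i c_i ⟪g_{w_i}, b⟫ u_i` (`DiagN.WN`; `W_c S = T_w W_c`, `cf W_c i = c_i`,
`W_c† u_i = c_i g_{w_i}`).  Two indices `j ≠ b`; coefficients `c_b := 3/(2κ)` (one LARGE eigen-coordinate) and
`c_i := κ := σ/(40 d)` otherwise (small but non-zero); bracket point `z := λ u_j` of `x₀ := λ (u_j + W W† u_j)` with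
`λ := ‖u_j + W W† u_j‖⁻¹` — so `z + W W† z = x₀` exactly, the state is the true MC minimiser at radius `ε₀ = ‖z‖ = λ`
(`IsBracket.isMinimal`), and `(εθ)₀ = ‖W† z‖² = λ² κ² ‖g_{w_j}‖²` ((16)).  The coordinates of `u_j + W W† u_j` are
`X_i = [i = j] + c_j c_i G_ij`, `G_ij = (1 − w_i w_j)⁻¹ ∈ [0.9999, 1.0002]` (`DiagN.Gm_bounds`): `X_b = (3/2) G_bj`
(`2.2 ≤ X_b² ≤ 2.251`), `X_j = 1 + κ² G_jj` (`X_j² ≤ 1.0005`), `X_i = κ² G_ij` (`X_i² ≤ 2κ⁴`) otherwise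
(`DiagN.Xc_bounds`), whence `2.2 ≤ ‖u_j + WW†u_j‖² ≤ 4` (`DiagN.norm_bracket_sq_bounds`), `λ² ∈ [1/4, 1/2.2]`,
`λ ∈ [0.3, 0.7]` (the window), `ε₀² = λ²`, `(εθ)₀ ≤ κ² ≤ σ²/6400`, `(22/σ + 1)(εθ)₀ ≤ (22σ + σ²)/6400 ≤ 0.0036`:
the margin `0.09 + (22/σ + 1)(εθ)₀ ≤ ε₀² ≤ 0.49 − (22/σ + 1)(εθ)₀` holds with room.  In words: the model run vector `y₀` has one eigen-coordinate of size `≍ d/σ` and all others of size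
`≍ σ/d`; `x₀` is (up to normalisation) `u_j + (3/2) u_b` plus an `O(σ²/d²)` tail — the picture of `Diag.exists_start_at`
(`d = 2`: `y = (Y₀, τ)`, `x₀ ∝ (1, ·)`) with `d − 2` further small eigen-coordinates switched on.

SCOPE.  A construction inside the finite-dimensional calibration; nothing here concerns the manuscript's operators.
Real weights `|w_i| ≤ 1/100` (any `τ ≤ σ/100` qualifies); `d ≥ 2` (for `d = 1` the margin is impossible: `H = ℂ`).
No new axioms; zero `sorry`.
-/

noncomputable section

open scoped InnerProductSpace ComplexConjugate ENNReal
open ContinuousLinearMap Filter Topology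

namespace Literature.Analysis.OperatorTheory.Enflo2023

namespace StepRealisation

open MCStep Vy
open Lemma1.Standing (e e_apply norm_e inner_e_left)

namespace DiagN

variable {d : ℕ}

/-! ### A. Intertwiners with prescribed real eigen-coefficients -/

section WN

variable {w : Fin d → ℝ} {τ : ℝ}

/-- THE MODEL INTERTWINERS `W_c b = Σ_i c_i ⟪g_{w_i}, b⟫ u_i` (real eigen-coefficients `c_i`); `W_c = V_y` for
`y = Σ c_i u_i`. [cite: Enflo2023, v2 (2)–(4) p.2] -/
def WN (w : Fin d → ℝ) (c : Fin d → ℝ) : ℓ2 →L[ℂ] Cd d :=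
  ∑ i, ((c i : ℝ) : ℂ) • (innerSL ℂ (Diag.gv (w i))).smulRight (u i)

/-- `W_c b = Σ (c_i ⟪g_{w_i}, b⟫) u_i`. [folklore] -/
lemma WN_apply_eq (c : Fin d → ℝ) (b : ℓ2) :
    WN w c b = ∑ i, (((c i : ℝ) : ℂ) * ⟪Diag.gv (w i), b⟫_ℂ) • u i := by
  simp only [WN, _root_.sum_apply, _root_.smul_apply, ContinuousLinearMap.smulRight_apply, innerSL_apply_apply,
    smul_smul]

/-- `(W_c b)_j = c_j ⟪g_{w_j}, b⟫`. [folklore] -/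
lemma WN_apply (c : Fin d → ℝ) (b : ℓ2) (j : Fin d) : WN w c b j = ((c j : ℝ) : ℂ) * ⟪Diag.gv (w j), b⟫_ℂ := by
  rw [WN_apply_eq, sum_smul_u_apply]

/-- `W_c` INTERTWINES: `W_c S = T_w W_c` (`⟪g_μ, S b⟫ = μ ⟪g_μ, b⟫`). [cite: Enflo2023, v2 (2)–(4) p.2] -/
lemma WN_intertwine (hw : ∀ i, |w i| < 1) (c : Fin d → ℝ) (b : ℓ2) : WN w c (S b) = TDg w (WN w c b) := by
  ext j
  rw [WN_apply, TDg_apply, WN_apply, Diag.inner_gv_S (hw j)]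
  ring

/-- the eigen-coefficients of `W_c` are the `c_i`. [folklore] -/
lemma cf_WN (hw : ∀ i, |w i| < 1) (c : Fin d → ℝ) (i : Fin d) : cf (WN w c) i = ((c i : ℝ) : ℂ) := by
  rw [cf_eq, WN_apply, Diag.inner_gv_e (hw i) 0, pow_zero, mul_one, Complex.conj_ofReal]

/-- `‖u_i‖ = 1`. [folklore] -/
lemma norm_u (i : Fin d) : ‖(u i : Cd d)‖ = 1 := by
  rw [u, EuclideanSpace.single, PiLp.norm_single, norm_one]

/-- `W_c† u_j = c_j g_{w_j}`. [cite: Enflo2023, v2 (4) p.2] -/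
lemma adjoint_WN_u (hw : ∀ i, |w i| < 1) (c : Fin d → ℝ) (j : Fin d) :
    adjoint (WN w c) (u j) = ((c j : ℝ) : ℂ) • Diag.gv (w j) := by
  rw [adjoint_u hw (WN_intertwine hw c) j, cf_WN hw]

/-- THE GRAM FACTORS `G_ij = ⟪g_{w_i}, g_{w_j}⟫ = (1 − w_i w_j)⁻¹`. [folklore] -/
def Gm (w : Fin d → ℝ) (i j : Fin d) : ℝ := (1 - w i * w j)⁻¹

/-- THE COORDINATES OF `u_j + W_c W_c† u_j`: `X_i = [i = j] + c_j c_i G_ij`. [cite: Enflo2023, v2 (15) p.6] -/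
def Xc (w : Fin d → ℝ) (c : Fin d → ℝ) (j i : Fin d) : ℝ := (if i = j then 1 else 0) + c j * c i * Gm w i j

/-- coordinates of the bracket vector. [cite: Enflo2023, v2 (15) p.6] -/
lemma bracket_coord (hw : ∀ i, |w i| < 1) (c : Fin d → ℝ) (j i : Fin d) :
    (u j + WN w c (adjoint (WN w c) (u j))) i = ((Xc w c j i : ℝ) : ℂ) := by
  rw [← inner_u_left, inner_add_right, inner_u_left, inner_u_left, u_apply, adjoint_WN_u hw c j, map_smul,
    ← inner_u_left, inner_smul_right, inner_u_left, WN_apply, Diag.inner_gv_gv (hw i) (hw j), Xc, Gm]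
  split_ifs <;> push_cast <;> ring

/-- the bracket vector in the basis. [cite: Enflo2023, v2 (15) p.6] -/
lemma bracket_eq (hw : ∀ i, |w i| < 1) (c : Fin d → ℝ) (j : Fin d) :
    u j + WN w c (adjoint (WN w c) (u j)) = ∑ i, ((Xc w c j i : ℝ) : ℂ) • u i := by
  conv_lhs => rw [decomp_u (u j + WN w c (adjoint (WN w c) (u j)))]
  refine Finset.sum_congr rfl (fun i _ => ?_)
  rw [bracket_coord hw c j i]

/-- `‖u_j + W W† u_j‖² = Σ X_i²`. [folklore] -/
lemma norm_bracket_sq (hw : ∀ i, |w i| < 1) (c : Fin d → ℝ) (j : Fin d) :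
    ‖u j + WN w c (adjoint (WN w c) (u j))‖ ^ 2 = ∑ i, Xc w c j i ^ 2 := by
  rw [bracket_eq hw c j, norm_sq_sum_smul_u]
  refine Finset.sum_congr rfl (fun i _ => ?_)
  rw [Complex.norm_real, Real.norm_eq_abs, sq_abs]

/-- bounds on the Gram factors for `|w_i| ≤ τ ≤ 1/100`: `0.9999 ≤ G_ij ≤ 1.0002`. [folklore] -/
lemma Gm_bounds (hwτ : ∀ i, |w i| ≤ τ) (hτ1 : τ ≤ 1 / 100) (i j : Fin d) :
    (0.9999 : ℝ) ≤ Gm w i j ∧ Gm w i j ≤ 1.0002 := by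
  have hp : |w i * w j| ≤ 1 / 10000 := by
    rw [abs_mul]
    calc |w i| * |w j| ≤ (1 / 100) * (1 / 100) :=
          mul_le_mul ((hwτ i).trans hτ1) ((hwτ j).trans hτ1) (abs_nonneg _) (by norm_num)
      _ = 1 / 10000 := by norm_num
  obtain ⟨hp1, hp2⟩ := abs_le.1 hp
  have hpos : 0 < 1 - w i * w j := by linarith
  constructor
  · rw [Gm, le_inv_comm₀ (by norm_num) hpos, show ((0.9999 : ℝ))⁻¹ = 10000 / 9999 by norm_num]
    linarith
  · rw [Gm, inv_le_comm₀ hpos (by norm_num), show ((1.0002 : ℝ))⁻¹ = 10000 / 10002 by norm_num]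
    linarith

end WN

/-! ### B. The start: one large eigen-coordinate, all others of size `σ/(40d)` -/

section start

variable {w : Fin d → ℝ} {τ : ℝ}

/-- the small coefficient `κ = σ/(40 d)`. [folklore] -/
def kap (σ : ℝ) (d : ℕ) : ℝ := σ / (40 * d)

/-- THE COEFFICIENTS OF THE START: `c_b = 3/(2κ)`, `c_i = κ` (`i ≠ b`). [cite: Enflo2023, v2 p.7 (choice of `y`)] -/
def cS (σ : ℝ) (b : Fin d) : Fin d → ℝ := fun i => if i = b then 3 / (2 * kap σ d) else kap σ d

/-- `κ > 0`. [folklore] -/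
lemma kap_pos {σ : ℝ} (hσ : 0 < σ) (hd : 2 ≤ d) : 0 < kap σ d := by
  have hd' : (2 : ℝ) ≤ d := by exact_mod_cast hd
  rw [kap]; positivity

/-- `κ ≤ σ/80`. [folklore] -/
lemma kap_le {σ : ℝ} (hσ : 0 < σ) (hd : 2 ≤ d) : kap σ d ≤ σ / 80 := by
  have hd' : (2 : ℝ) ≤ d := by exact_mod_cast hd
  rw [kap, div_le_iff₀ (by positivity : (0 : ℝ) < 40 * d)]
  have e : σ / 80 * (40 * (d : ℝ)) = σ * d / 2 := by ring
  rw [e]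
  nlinarith

/-- `κ² ≤ σ²/6400 ≤ 1/6400` and `d κ⁴ ≤ 10⁻⁷`. [folklore] -/
lemma kap_sq_le {σ : ℝ} (hσ : 0 < σ) (hσ1 : σ ≤ 1) (hd : 2 ≤ d) :
    kap σ d ^ 2 ≤ σ ^ 2 / 6400 ∧ kap σ d ^ 2 ≤ 1 / 6400 ∧ (d : ℝ) * kap σ d ^ 4 ≤ 1 / 10000000 := by
  have hd' : (2 : ℝ) ≤ d := by exact_mod_cast hd
  have hd0 : (d : ℝ) ≠ 0 := by positivity
  have hk0 := (kap_pos hσ hd).le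
  have hA : kap σ d ^ 2 ≤ σ ^ 2 / 6400 :=
    calc kap σ d ^ 2 ≤ (σ / 80) ^ 2 := pow_le_pow_left₀ hk0 (kap_le hσ hd) 2
      _ = σ ^ 2 / 6400 := by ring
  have hB : kap σ d ^ 2 ≤ 1 / 6400 :=
    hA.trans (div_le_div_of_nonneg_right (by nlinarith) (by norm_num))
  have hC : (d : ℝ) * kap σ d ^ 2 ≤ 1 / 1600 := by
    have e : (d : ℝ) * kap σ d ^ 2 = σ ^ 2 / (1600 * d) := by
      rw [kap]; field_simp; ring
    rw [e, div_le_iff₀ (by positivity)]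
    nlinarith
  refine ⟨hA, hB, ?_⟩
  calc (d : ℝ) * kap σ d ^ 4 = ((d : ℝ) * kap σ d ^ 2) * kap σ d ^ 2 := by ring
    _ ≤ 1 / 1600 * (1 / 6400) := mul_le_mul hC hB (sq_nonneg _) (by norm_num)
    _ ≤ 1 / 10000000 := by norm_num

/-- THE COORDINATE BOUNDS of `u_j + W W† u_j` for the start coefficients (`j ≠ b`, `|w_i| ≤ τ ≤ 1/100`):
`2.2 ≤ X_b²`, `X_b² ≤ 2.251`, `X_j² ≤ 1.0005`, `X_i² ≤ 2κ⁴` otherwise. [folklore] -/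
lemma Xc_bounds (hwτ : ∀ i, |w i| ≤ τ) (hτ1 : τ ≤ 1 / 100) {σ : ℝ} (hσ : 0 < σ) (hσ1 : σ ≤ 1) (hd : 2 ≤ d)
    {j b : Fin d} (hjb : j ≠ b) (i : Fin d) :
    ((2.2 : ℝ) ≤ Xc w (cS σ b) j b ^ 2 ∧ Xc w (cS σ b) j b ^ 2 ≤ 2.251) ∧
      Xc w (cS σ b) j j ^ 2 ≤ 1.0005 ∧
      (i ≠ b → i ≠ j → Xc w (cS σ b) j i ^ 2 ≤ 2 * kap σ d ^ 4) := by
  have hk0 := kap_pos hσ hd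
  obtain ⟨-, hk2', -⟩ := kap_sq_le hσ hσ1 hd
  have hcj : cS σ b j = kap σ d := by rw [cS]; exact if_neg hjb
  have hcb : cS σ b b = 3 / (2 * kap σ d) := by rw [cS]; exact if_pos rfl
  refine ⟨?_, ?_, ?_⟩
  · -- `X_b = (3/2) G_bj`
    obtain ⟨hG1, hG2⟩ := Gm_bounds hwτ hτ1 b j
    have hX : Xc w (cS σ b) j b = 3 / 2 * Gm w b j := by
      rw [Xc, if_neg (Ne.symm hjb), hcj, hcb]; field_simp; ring
    rw [hX]
    constructor <;> nlinarith
  · -- `X_j = 1 + κ² G_jj`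
    obtain ⟨hG1, hG2⟩ := Gm_bounds hwτ hτ1 j j
    have hX : Xc w (cS σ b) j j = 1 + kap σ d ^ 2 * Gm w j j := by
      rw [Xc, if_pos rfl, hcj]; ring
    rw [hX]
    have h0 : 0 ≤ kap σ d ^ 2 * Gm w j j := mul_nonneg (sq_nonneg _) (by linarith)
    have h1 : kap σ d ^ 2 * Gm w j j ≤ 1 / 6400 * 1.0002 :=
      mul_le_mul hk2' hG2 (by linarith) (by norm_num)
    nlinarith
  · intro hib hij
    obtain ⟨hG1, hG2⟩ := Gm_bounds hwτ hτ1 i j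
    have hci : cS σ b i = kap σ d := by rw [cS]; exact if_neg hib
    have hX : Xc w (cS σ b) j i = kap σ d ^ 2 * Gm w i j := by
      rw [Xc, if_neg hij, hcj, hci]; ring
    rw [hX, mul_pow]
    have hG4 : Gm w i j ^ 2 ≤ 2 := by nlinarith
    have hk4 : 0 ≤ (kap σ d ^ 2) ^ 2 := sq_nonneg _
    nlinarith

/-- THE NORM OF THE BRACKET VECTOR: `2.2 ≤ ‖u_j + W W† u_j‖² ≤ 4`. [folklore] -/
lemma norm_bracket_sq_bounds (hwτ : ∀ i, |w i| ≤ τ) (hτ1 : τ ≤ 1 / 100) {σ : ℝ} (hσ : 0 < σ) (hσ1 : σ ≤ 1)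
    (hd : 2 ≤ d) {j b : Fin d} (hjb : j ≠ b) :
    (2.2 : ℝ) ≤ ‖u j + WN w (cS σ b) (adjoint (WN w (cS σ b)) (u j))‖ ^ 2 ∧
      ‖u j + WN w (cS σ b) (adjoint (WN w (cS σ b)) (u j))‖ ^ 2 ≤ 4 := by
  have hw : ∀ i, |w i| < 1 := fun i => lt_of_le_of_lt ((hwτ i).trans hτ1) (by norm_num)
  rw [norm_bracket_sq hw]
  obtain ⟨-, -, hdk⟩ := kap_sq_le hσ hσ1 hd
  constructor
  · obtain ⟨⟨hb1, -⟩, -, -⟩ := Xc_bounds hwτ hτ1 hσ hσ1 hd hjb b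
    exact hb1.trans (Finset.single_le_sum (f := fun i => Xc w (cS σ b) j i ^ 2) (fun i _ => sq_nonneg _)
      (Finset.mem_univ b))
  · -- pointwise majorant `B_i = [i = b]·2.251 + [i = j]·1.0005 + 2κ⁴`
    have hpt : ∀ i, Xc w (cS σ b) j i ^ 2 ≤
        (if i = b then (2.251 : ℝ) else 0) + (if i = j then (1.0005 : ℝ) else 0) + 2 * kap σ d ^ 4 := by
      intro i
      obtain ⟨⟨-, hb2⟩, hj2, hrest⟩ := Xc_bounds hwτ hτ1 hσ hσ1 hd hjb i
      have hk4 : 0 ≤ 2 * kap σ d ^ 4 := by positivity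
      by_cases hib : i = b
      · subst hib; rw [if_pos rfl, if_neg (Ne.symm hjb)]; linarith
      · by_cases hij : i = j
        · subst hij; rw [if_neg hib, if_pos rfl]; linarith
        · rw [if_neg hib, if_neg hij]; linarith [hrest hib hij]
    calc ∑ i, Xc w (cS σ b) j i ^ 2
        ≤ ∑ i, ((if i = b then (2.251 : ℝ) else 0) + (if i = j then (1.0005 : ℝ) else 0) + 2 * kap σ d ^ 4) :=
          Finset.sum_le_sum (fun i _ => hpt i)
      _ = 2.251 + 1.0005 + (d : ℝ) * (2 * kap σ d ^ 4) := by
          rw [Finset.sum_add_distrib, Finset.sum_add_distrib, Finset.sum_ite_eq' Finset.univ b,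
            Finset.sum_ite_eq' Finset.univ j, if_pos (Finset.mem_univ _), if_pos (Finset.mem_univ _),
            Finset.sum_const, Finset.card_univ, Fintype.card_fin, nsmul_eq_mul]
      _ ≤ 4 := by nlinarith

/-- window arithmetic: `1/4 ≤ λ² ≤ 1/2.2` puts `λ` inside `[0.3, 0.7]`. [folklore] -/
lemma window_of_sq {l : ℝ} (hl0 : 0 < l) (h1 : 1 / 4 ≤ l ^ 2) (h2 : l ^ 2 ≤ 1 / 2.2) :
    (0.3 : ℝ) ≤ l ∧ l ≤ 0.7 := by
  constructor <;> nlinarith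

/-- `(εθ)₀ = λ²κ²‖g‖² ≤ κ²` for `λ² ≤ 1/2.2`, `‖g‖² ≤ 4/3`. [folklore] -/
lemma etheta_aux {l2 k2 g2 : ℝ} (hl : l2 ≤ 1 / 2.2) (hg : g2 ≤ 4 / 3) (hg0 : 0 ≤ g2) (hk : 0 ≤ k2) :
    l2 * k2 * g2 ≤ k2 :=
  calc l2 * k2 * g2 = (l2 * g2) * k2 := by ring
    _ ≤ (1 / 2.2 * (4 / 3)) * k2 := mul_le_mul_of_nonneg_right (mul_le_mul hl hg hg0 (by norm_num)) hk
    _ ≤ k2 := mul_le_of_le_one_left hk (by norm_num)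

/-- the margin constant: `(22/σ + 1)·σ²/6400 ≤ 0.0036` for `0 < σ ≤ 1`. [folklore] -/
lemma margin_aux {σ : ℝ} (hσ : 0 < σ) (hσ1 : σ ≤ 1) : (22 / σ + 1) * (σ ^ 2 / 6400) ≤ 0.0036 := by
  have hs2 : σ ^ 2 ≤ 1 := by nlinarith
  have hσ0 : σ ≠ 0 := hσ.ne'
  have e22 : (22 / σ + 1) * (σ ^ 2 / 6400) = (22 * σ + σ ^ 2) / 6400 := by
    field_simp
  rw [e22, div_le_iff₀ (by norm_num : (0 : ℝ) < 6400)]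
  norm_num
  linarith

/-- **ADMISSIBLE CYCLIC STARTS EXIST IN EVERY DIMENSION `d ≥ 2`**, for every real weight vector `|w_i| ≤ τ ≤ 1/100`
and every modulus `0 < σ ≤ 1`: a unit `x₀ ∈ ℂ^d` and a true MC state `s₀` of an intertwiner `V S = T_w V` with
`(εθ)₀ > 0`, the run's start margin, and NO vanishing eigen-coordinate of `y₀`.
[cite: Enflo2023, v2 (2)–(4) p.2, (15)–(16) p.6, p.7, p.17 (window of `ε`)] -/
theorem exists_start (hd : 2 ≤ d) (hwτ : ∀ i, |w i| ≤ τ) (hτ1 : τ ≤ 1 / 100) {σ : ℝ} (hσ : 0 < σ)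
    (hσ1 : σ ≤ 1) :
    ∃ (x₀ : Cd d) (s₀ : State (TDg w) x₀ S), ‖x₀‖ = 1 ∧ 0 < s₀.etheta ∧
      ((0.09 : ℝ) + (22 / σ + 1) * s₀.etheta ≤ s₀.ε ^ 2 ∧ s₀.ε ^ 2 + (22 / σ + 1) * s₀.etheta ≤ 0.49) ∧
      ∀ i, cf s₀.V i ≠ 0 := by
  have hw : ∀ i, |w i| < 1 := fun i => lt_of_le_of_lt ((hwτ i).trans hτ1) (by norm_num)
  -- two distinct indices
  obtain ⟨j, b, hjb⟩ : ∃ j b : Fin d, j ≠ b :=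
    ⟨⟨0, by omega⟩, ⟨1, by omega⟩, fun h => absurd (congrArg Fin.val h) (by norm_num)⟩
  obtain ⟨hN1, hN2⟩ := norm_bracket_sq_bounds (w := w) hwτ hτ1 hσ hσ1 hd hjb
  -- the intertwiner
  obtain ⟨W, hW⟩ : ∃ W : ℓ2 →L[ℂ] Cd d, WN w (cS σ b) = W := ⟨_, rfl⟩
  rw [hW] at hN1 hN2
  have hWS : ∀ v, W (S v) = TDg w (W v) := by rw [← hW]; exact WN_intertwine hw _
  have hk0 := kap_pos hσ hd
  have hadjW : adjoint W (u j) = ((kap σ d : ℝ) : ℂ) • Diag.gv (w j) := by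
    rw [← hW, adjoint_WN_u hw, cS, if_neg hjb]
  have hcf : ∀ i, cf W i ≠ 0 := by
    intro i
    rw [← hW, cf_WN hw, Ne, Complex.ofReal_eq_zero, cS]
    split_ifs
    · positivity
    · exact hk0.ne'
  -- the bracket vector and the scale `λ = 1/‖X‖`
  obtain ⟨X, hX⟩ : ∃ X : Cd d, u j + W (adjoint W (u j)) = X := ⟨_, rfl⟩
  rw [hX] at hN1 hN2
  have hN0 : 0 < ‖X‖ := by
    rcases (norm_nonneg X).eq_or_lt with h | h
    · rw [← h] at hN1; norm_num at hN1
    · exact h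
  obtain ⟨l, hl⟩ : ∃ l : ℝ, ‖X‖⁻¹ = l := ⟨_, rfl⟩
  have hl0 : 0 < l := by rw [← hl]; exact inv_pos.2 hN0
  have hlN : l * ‖X‖ = 1 := by rw [← hl]; exact inv_mul_cancel₀ hN0.ne'
  have hN20 : 0 < ‖X‖ ^ 2 := by positivity
  have hl2 : l ^ 2 = (‖X‖ ^ 2)⁻¹ := by rw [← hl, inv_pow]
  have hl2lo : (1 / 4 : ℝ) ≤ l ^ 2 := by
    rw [hl2, le_inv_comm₀ (by norm_num) hN20, show ((1 : ℝ) / 4)⁻¹ = 4 by norm_num]; exact hN2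
  have hl2hi : l ^ 2 ≤ 1 / 2.2 := by
    rw [hl2, inv_le_comm₀ hN20 (by norm_num), show ((1 : ℝ) / 2.2)⁻¹ = 2.2 by norm_num]; exact hN1
  have hwin : (0.3 : ℝ) ≤ l ∧ l ≤ 0.7 := window_of_sq hl0 hl2lo hl2hi
  -- `x₀`, `z`, the bracket
  obtain ⟨x₀, hx₀⟩ : ∃ x₀ : Cd d, ((l : ℝ) : ℂ) • X = x₀ := ⟨_, rfl⟩
  obtain ⟨z, hz⟩ : ∃ z : Cd d, ((l : ℝ) : ℂ) • u j = z := ⟨_, rfl⟩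
  have hx₀n : ‖x₀‖ = 1 := by
    rw [← hx₀, norm_smul, Complex.norm_real, Real.norm_of_nonneg hl0.le, hlN]
  have hzn : ‖z‖ = l := by
    rw [← hz, norm_smul, Complex.norm_real, Real.norm_of_nonneg hl0.le, norm_u, mul_one]
  have hbr : IsBracket W x₀ z := by
    show z + W (adjoint W z) = x₀
    rw [← hz, map_smul, map_smul, ← smul_add, hX, hx₀]
  have hwin' : (0.3 : ℝ) ≤ ‖z‖ ∧ ‖z‖ ≤ 0.7 := by rw [hzn]; exact hwin
  have hadj : adjoint W z = (((l * kap σ d : ℝ)) : ℂ) • Diag.gv (w j) := by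
    rw [← hz, map_smul, hadjW, smul_smul, ← Complex.ofReal_mul]
  -- the number `(εθ)₀ = λ² κ² ‖g_{w_j}‖²` and the margin
  obtain ⟨hk2, -, -⟩ := kap_sq_le hσ hσ1 hd
  have hg := norm_gv_sq_le (show |w j| ≤ 1 / 2 from ((hwτ j).trans hτ1).trans (by norm_num))
  have hg1 := Diag.one_le_norm_gv (hw j)
  have hE0 : 0 < (l * kap σ d) ^ 2 * ‖Diag.gv (w j)‖ ^ 2 :=
    mul_pos (by positivity) (pow_pos (lt_of_lt_of_le one_pos hg1) 2)
  have hE1 : (l * kap σ d) ^ 2 * ‖Diag.gv (w j)‖ ^ 2 ≤ kap σ d ^ 2 := by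
    rw [mul_pow]
    exact etheta_aux hl2hi hg (sq_nonneg _) (sq_nonneg _)
  have hK0 : 0 ≤ 22 / σ + 1 := by positivity
  have hm : (22 / σ + 1) * ((l * kap σ d) ^ 2 * ‖Diag.gv (w j)‖ ^ 2) ≤ 0.0036 :=
    ((mul_le_mul_of_nonneg_left (hE1.trans hk2) hK0)).trans (margin_aux hσ hσ1)
  -- the state
  let s₀ : State (TDg w) x₀ S := ⟨W, hWS, ‖z‖, hwin', _, hbr.isMinimal⟩
  have hv : s₀.v = z := hbr.sub_eq
  have he : s₀.etheta = (l * kap σ d) ^ 2 * ‖Diag.gv (w j)‖ ^ 2 := by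
    rw [etheta_eq_eth, hv, eth_eq_of_isBracket hbr, hadj, norm_smul, Complex.norm_real,
      Real.norm_of_nonneg (by positivity), mul_pow]
  have hε : s₀.ε = l := hzn
  refine ⟨x₀, s₀, hx₀n, ?_, ⟨?_, ?_⟩, hcf⟩
  · rw [he]; exact hE0
  · rw [he, hε]; linarith only [hm, hl2lo]
  · rw [he, hε]; linarith only [hm, hl2hi]

/-- **THE ORBIT RESIDUAL FAILS, NON-VACUOUSLY, IN EVERY DIMENSION `d ≥ 2`**: for every real diagonal operator `T_w`
on `ℂ^d` with simple spectrum `|w_i| ≤ τ ≤ σ/100`, `0 < σ ≤ 1`, `0 < β ≤ σ²/1000`, there is an admissible cyclic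
start at which `IndepRunD` (hence `IndepRunκ`) is false and the finite-depth floor of the orbit tree holds.
[cite: Enflo2023, v2 (34) p.16; (45) p.19, l.656–677] -/
theorem not_indepRunD (hd : 2 ≤ d) (hinj : Function.Injective w) (hwτ : ∀ i, |w i| ≤ τ) {σ β : ℝ}
    (hσ : 0 < σ) (hσ1 : σ ≤ 1) (hτσ : τ ≤ σ / 100) (hβ0 : 0 < β) (hβ : β ≤ σ ^ 2 / 1000) :
    ∃ (x₀ : Cd d) (s₀ : State (TDg w) x₀ S), ‖x₀‖ = 1 ∧ 0 < s₀.etheta ∧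
      ((0.09 : ℝ) + (22 / σ + 1) * s₀.etheta ≤ s₀.ε ^ 2 ∧ s₀.ε ^ 2 + (22 / σ + 1) * s₀.etheta ≤ 0.49) ∧
      (∀ i, cf s₀.V i ≠ 0) ∧
      ¬ IndepRunD (TDg w) x₀ S (ιS S) σ β s₀ ∧ ¬ IndepRunκ (TDg w) x₀ S (ιS S) σ β s₀ ∧
      ∃ n₀ : ℕ, ∀ s : State (TDg w) x₀ S, ReachD (ιS S) σ β s₀ s → (1 - β) ^ n₀ * s₀.etheta ≤ s.etheta := by
  have hτ1 : τ ≤ 1 / 100 := by linarith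
  obtain ⟨x₀, s₀, hx₀, he, hstart, hcyc⟩ := exists_start hd hwτ hτ1 hσ hσ1
  exact ⟨x₀, s₀, hx₀, he, hstart, hcyc,
    fun h => he.ne' (indepRunD_etheta_eq_zero hinj hwτ hx₀ hσ hσ1 hτσ hβ0 hβ s₀ hstart hcyc h),
    fun h => he.ne' (indepRunκ_etheta_eq_zero hinj hwτ hx₀ hσ hσ1 hτσ hβ0 hβ s₀ hstart hcyc h),
    reachD_etheta_floor hinj hwτ hx₀ hσ hσ1 hτσ hβ0 hβ s₀ he hcyc⟩

end start

end DiagN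

end StepRealisation

end Literature.Analysis.OperatorTheory.Enflo2023

end
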